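import Summits.BirchSwinnertonDyer.Rank1Residual.X11b.FrameIdealRigidity
import HarnessLib

/-!
# X11b — the two BDP frames differ by a unit OF THE IWASAWA ALGEBRA `Λ = ℤ_p⟦T⟧`; the `R₀`-frame twin
# (x11b3's currency `IsBDPLFunction`, `L ∈ R₀⟦T⟧`): equal ideals of `R₀⟦T⟧`

HONEST FRAMING (cell `b2b-bsdres`, run/shared/lean/b2b/bsd-rank1-residual/, verbatim in every
file): the goal of the cell is to DELETE the COMBINATION-SHAPED residual classes of the
Birch–Swinnerton-Dyer formula for ALL analytic-rank `≤ 1` elliptic curves over `ℚ` — "full BSD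
formula for every rank `≤ 1` curve in class `C`" assembled STRICTLY from published theorems — so
that the rank-`≤ 1` remainder becomes exactly the CONSTRUCTION-SHAPED classes, which are TYPED
(missing-input `Prop`s), NOT attempted. This is not "finishing BSD". Sub-cell
`b2b-bsdres-multr1-p1` (X11b, route R1, gen 25); THEOREMS ONLY (no definition, no named fact, no
`sorry`); valid at every ODD prime `p`; nothing here changes a label.

## What this file proves (sharpening of `FrameIdealRigidity`, INTENT addendum HOME/INBOX.md 2026-08-21)

* §1 **`R1.exists_binomialSeries_mul_eq_of_values`** (σ exposed, the shape x11b3 asked for): in the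
  situation of `R1.exists_unit_mul_eq_of_values`, `∃ σ : ℤ_p, (Q = 0 ∧ Q' = 0) ∨ Q' = (1+T)^σ·Q`;
  **`R1.exists_iwasawaUnit_mul_eq_of_values`**: the unit can be taken in the IMAGE OF `Λ = ℤ_p⟦T⟧`:
  `Q' = (map U)·Q` with `U ∈ Λˣ` (`U = 1` in the separated case, `U = (1+T)^σ ∈ ℤ_p⟦T⟧` otherwise).
* §2 **`R1.exists_frameValues_of_isBDPLFunctionInt`** (the test data of two ♭-frames, packaged once:
  `x, b, V, V'` with `‖x − 1‖ < p⁻¹`, `x ≠ 1`, `b ≠ 0`, `Q(x^j − 1) = V_j`, `Q'(x^j − 1) = V'_j`,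
  `V'_j = b^j V_j` for `j ≥ 1`) and **`R1.exists_iwasawaUnit_mul_eq_of_isBDPLFunctionInt`**: two
  ♭-frames of the same `(ι, 𝔭, κ, γ, f)` with non-zero periods differ by a unit of `Λ`.
* §3 the **`R₀`-FRAME TWIN**: for `L, L' ∈ R₀⟦T⟧` with `IsBDPLFunction ι 𝔭 κ γ f Ω_K Ω_p L` and
  `IsBDPLFunction ι 𝔭 κ γ f Ω_K' Ω_p' L'` (x11b3's currency; `R₀ ⊆ 𝓞_{ℂ_p}` via `R1.unrToCpInt`,
  injective): **`R1.exists_iwasawaUnit_mul_eq_of_isBDPLFunction`** (`L' = (map U)·L`, `U ∈ Λˣ`) and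
  **`R1.span_singleton_eq_of_isBDPLFunction`**: `Ideal.span {L'} = Ideal.span {L}` in `R₀⟦T⟧` — so
  every `R₀⟦T⟧`-ideal statement about "the" BDP `p`-adic `L`-function `(L)` (x11b3's ∀-over-`L`
  halves `Three.IMCDivAt₃`, route R1's gen-20/21 `R₀`-shapes) is independent of the frame.
* §4 (appended) route R1's H3 predicates pointwise: **`R1.imcEqOnTreeAt_iff_of_isBDPLFunction`**,
  **`R1.imcEqOnTreeAt_forall_of_exists`** (`R₀`-currency `R1.IMCEqOnTreeAt`) and
  **`R1.imcEqIntAt_forall_of_exists`** (♭-currency `R1.IMCEqIntAt`): ∀-frame ⟸ ∃-frame.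

References: [Castella2018] Thm. 3.1 (arXiv:1704.06608 p. 9); [CastellaHsieh2018] §3.3;
[Washington1997] §5.1, §7.1 (`Λ = ℤ_p⟦T⟧`, the functions `(1+T)^x`).
-/

noncomputable section

open scoped Classical Topology NumberField
open Filter Finset NumberField IsDedekindDomain Field PowerSeries
open Literature.NumberTheory.EllipticCurves Literature.NumberTheory.GaloisRepresentations
open Summit.BirchSwinnertonDyer.Rank1Residual.X11b.Three.LambdaSupply
open Summit.BirchSwinnertonDyer.Rank1Residual.X11b.LambdaSupply
open Summit.BirchSwinnertonDyer.Rank1Residual.X11b.Three.LambdaSupply.PadicUnits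
open Summit.BirchSwinnertonDyer.Rank1Residual.X11b.Halves

namespace Summit.BirchSwinnertonDyer.Rank1Residual.X11b

variable {p : ℕ} [Fact p.Prime]

/-! ### §1 The unit lives in `Λ = ℤ_p⟦T⟧` -/

/-- **Frames tied along the powers of a principal unit: both vanish, or they differ by a binomial
series `(1+T)^σ`, `σ ∈ ℤ_p` (σ EXPOSED).** Let `Q, Q' ∈ 𝓞_{ℂ_p}⟦T⟧`, `x ∈ ℂ_p` with `‖x − 1‖ < p⁻¹`,
`x ≠ 1`, `b ≠ 0`, and values `Q(x^j − 1) = V_j`, `Q'(x^j − 1) = V'_j` with `V'_j = b^j V_j` for `j ≥ 1`.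
Then there is `σ ∈ ℤ_p` with: `Q = Q' = 0` (the case `b` separated from `{x^n}`,
`R1.eq_zero_of_separated`), or `Q' = (Σ_n C(σ,n) Tⁿ)·Q` with `b = χ(σ)` for the `ℤ_p`-power character `χ`
of `x` (`R1.mem_range_of_not_separated`, `R1.binomialUnit_hasValueAt`, identity principle). The shape
asked for by x11b3 (S29 K2, HOME/INBOX.md 2026-08-21 14:02Z). [cite: Washington1997, §5.1 and §7.1] -/
theorem R1.exists_binomialSeries_mul_eq_of_values {Q Q' : PowerSeries 𝓞_ℂ_[p]} {x b : ℂ_[p]}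
    {V V' : ℕ → ℂ_[p]} (hx : ‖x - 1‖ < (p : ℝ)⁻¹) (hx1 : x ≠ 1) (hb : b ≠ 0)
    (hV : ∀ j, IntSeries.HasValueAt Q (x ^ j - 1) (V j))
    (hV' : ∀ j, IntSeries.HasValueAt Q' (x ^ j - 1) (V' j)) (hrel : ∀ j, 0 < j → V' j = b ^ j * V j) :
    ∃ σ : ℤ_[p], (Q = 0 ∧ Q' = 0) ∨
      Q' = PowerSeries.map (R1.toCpInt p) (binomialSeries ℤ_[p] σ) * Q := by
  have hp : p.Prime := Fact.out
  have hp1' : (p : ℝ)⁻¹ < 1 := inv_lt_one_of_one_lt₀ (by exact_mod_cast hp.one_lt)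
  have hxlt : ‖x - 1‖ < 1 := hx.trans hp1'
  by_cases hsep : ∃ δ : ℝ, 0 < δ ∧ ∀ n : ℤ, δ ≤ ‖b - x ^ n‖
  · obtain ⟨δ, hδ0, hδ⟩ := hsep
    exact ⟨0, Or.inl ⟨R1.eq_zero_of_separated hx hx1 hb hδ0 hδ hV hV' hrel,
      R1.eq_zero_of_separated' hx hx1 hb hδ0 hδ hV hV' hrel⟩⟩
  · -- `b = χ(σ)` for the `ℤ_p`-power character of `x`
    obtain ⟨χ, hχc, hχ1, -⟩ := exists_zpPow (p := p) (F := ℂ_[p]) (b := x)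
      (by rwa [← norm_neg, neg_sub])
    obtain ⟨σ, hσ⟩ := R1.mem_range_of_not_separated χ hχc hχ1 hsep
    refine ⟨Multiplicative.toAdd σ, Or.inr ?_⟩
    set U : PowerSeries 𝓞_ℂ_[p] := (binomialSeries ℤ_[p] (Multiplicative.toAdd σ)).map (R1.toCpInt p)
      with hU
    -- values of `U` at `x^j − 1`: `b^j`, through the character `χ^j`
    have hUval : ∀ j : ℕ, IntSeries.HasValueAt U (x ^ j - 1) (b ^ j) := by
      intro j
      set ψ : Multiplicative ℤ_[p] →* ℂ_[p]ˣ := (powMonoidHom j).comp χ with hψ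
      have hψc : Continuous ψ := (continuous_pow j).comp hχc
      have hψ1 : ((ψ (Multiplicative.ofAdd 1) : ℂ_[p]ˣ) : ℂ_[p]) = x ^ j := by
        rw [hψ, MonoidHom.comp_apply, powMonoidHom_apply, Units.val_pow_eq_pow_val, hχ1]
      have h := R1.binomialUnit_hasValueAt ((R1.norm_pow_sub_one_le hxlt j).trans_lt hxlt)
        ψ hψc hψ1 (Multiplicative.toAdd σ)
      rw [ofAdd_toAdd, hψ, MonoidHom.comp_apply, powMonoidHom_apply, Units.val_pow_eq_pow_val, hσ] at h
      exact h
    -- `Q'` and `U·Q` agree at `x^j − 1`, `j ≥ 1`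
    have hUQ : ∀ j, 0 < j → IntSeries.HasValueAt (U * Q) (x ^ j - 1) (V' j) := by
      intro j hj
      rw [hrel j hj]
      exact intSeries_hasValueAt_mul ((R1.norm_pow_sub_one_le hxlt j).trans_lt hxlt) (hUval j) (hV j)
    -- identity principle along `x^{p^k} − 1`
    have hlim : Tendsto (fun k : ℕ ↦ x ^ p ^ k - 1) atTop (𝓝 0) := by
      have h := (tendsto_pow_prime_pow_padicComplex (p := p) hxlt).sub_const 1
      rwa [sub_self] at h
    have hne : ∃ᶠ k in atTop, x ^ p ^ k - 1 ≠ 0 := by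
      refine Frequently.of_forall fun k h => hx1 ?_
      have hk : ‖x ^ p ^ k - 1‖ = ((p : ℝ)⁻¹) ^ k * ‖x - 1‖ := R1.norm_pow_prime_pow_sub_one hx k
      rw [h, norm_zero] at hk
      have hpk : 0 < ((p : ℝ)⁻¹) ^ k := pow_pos (inv_pos.mpr (by exact_mod_cast hp.pos)) k
      have : ‖x - 1‖ = 0 := by nlinarith [norm_nonneg (x - 1)]
      exact sub_eq_zero.mp (norm_eq_zero.mp this)
    exact R1.intSeries_eq_of_hasValueAt (x := fun k => x ^ p ^ k - 1) (v := fun k => V' (p ^ k)) hlim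
      hne (fun k => hV' (p ^ k)) (fun k => hUQ (p ^ k) (pow_pos hp.pos k))

/-- **Frames tied along the powers of a principal unit differ by a unit of `Λ`.** Let
`Q, Q' ∈ 𝓞_{ℂ_p}⟦T⟧`, `x ∈ ℂ_p` with `‖x − 1‖ < p⁻¹`, `x ≠ 1`, `b ≠ 0`, and values
`Q(x^j − 1) = V_j`, `Q'(x^j − 1) = V'_j` with `V'_j = b^j V_j` for `j ≥ 1`. Then `Q' = Ū·Q` where `Ū` is the
image in `𝓞_{ℂ_p}⟦T⟧` of a UNIT `U` of the Iwasawa algebra `Λ = ℤ_p⟦T⟧`: `U = 1` if `b` is separated from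
`{x^n}` (then `Q = Q' = 0`, `R1.eq_zero_of_separated`), and `U = (1+T)^σ = Σ C(σ,n) Tⁿ ∈ ℤ_p⟦T⟧` with
`b = χ(σ)` otherwise (`R1.mem_range_of_not_separated`, `R1.binomialUnit_hasValueAt`, identity
principle). Sharpens `R1.exists_unit_mul_eq_of_values`. [cite: Washington1997, §5.1 and §7.1] -/
theorem R1.exists_iwasawaUnit_mul_eq_of_values {Q Q' : PowerSeries 𝓞_ℂ_[p]} {x b : ℂ_[p]}
    {V V' : ℕ → ℂ_[p]} (hx : ‖x - 1‖ < (p : ℝ)⁻¹) (hx1 : x ≠ 1) (hb : b ≠ 0)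
    (hV : ∀ j, IntSeries.HasValueAt Q (x ^ j - 1) (V j))
    (hV' : ∀ j, IntSeries.HasValueAt Q' (x ^ j - 1) (V' j)) (hrel : ∀ j, 0 < j → V' j = b ^ j * V j) :
    ∃ U : IwasawaAlgebra p, IsUnit U ∧ Q' = PowerSeries.map (R1.toCpInt p) U * Q := by
  obtain ⟨σ, h⟩ := R1.exists_binomialSeries_mul_eq_of_values hx hx1 hb hV hV' hrel
  rcases h with ⟨hQ, hQ'⟩ | h
  · exact ⟨1, isUnit_one, by rw [hQ, hQ', mul_zero]⟩
  · refine ⟨binomialSeries ℤ_[p] σ, ?_, h⟩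
    rw [isUnit_iff_constantCoeff, binomialSeries_constantCoeff]
    exact isUnit_one

/-! ### §2 ♭-frames: the test data, and the unit of `Λ` -/

section Frames

variable {K : Type} [Field K] [NumberField K] {N : ℕ} {ι : PadicAlgCl p ≃+* ℂ}
  {𝔭 : HeightOneSpectrum (𝓞 K)} {κ : ZpExtension K p} {γ : Field.absoluteGaloisGroup K}
  {f : CuspForm (CongruenceSubgroup.Gamma0 N) 2} {ΩK ΩK' : ℂ} {Ωp Ωp' : ℂ_[p]}
  {Q Q' : PowerSeries 𝓞_ℂ_[p]}

/-- **The test data of two ♭-frames.** At an odd prime `p`, over an imaginary quadratic `K`, for an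
anticyclotomic `κ` with topological generator `γ` and two ♭-frames `R1.IsBDPLFunctionInt p ι 𝔭 κ γ f Ω_K Ω_p Q`,
`… Ω_K' Ω_p' Q'` with non-zero periods, there are `x, b ∈ ℂ_p` and value sequences `V, V'` with
`‖x − 1‖ < p⁻¹`, `x ≠ 1`, `b ≠ 0`, `Q(x^j − 1) = V_j`, `Q'(x^j − 1) = V'_j` and `V'_j = b^j·V_j` (`j ≥ 1`):
`x = φ̂₀(γ)^{p^a}` for multr1-p2's interpolation character `φ₀` (`exists_interpolationCharacter`),
`b = β^{m p^a}` with `β = ι⁻¹((Ω_K/Ω_K')⁴)(Ω_p'/Ω_p)⁴` (`intSeries_hasValueAt_frame_rescale`). (The body of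
`R1.exists_unit_mul_eq_of_isBDPLFunctionInt`, packaged once for its sharpenings.)
[cite: Castella2018, Thm. 3.1 (arXiv:1704.06608 p. 9)] [cite: CastellaHsieh2018, §3.3, Def. 3.5 and Prop. 3.6] -/
theorem R1.exists_frameValues_of_isBDPLFunctionInt (hp2 : p ≠ 2) (hK : IsImaginaryQuadratic K)
    (hκ : κ.IsAnticyclotomic) (hγ : κ.IsTopGenerator γ) (hΩK : ΩK ≠ 0) (hΩK' : ΩK' ≠ 0)
    (hΩp : Ωp ≠ 0) (hΩp' : Ωp' ≠ 0) (hQ : R1.IsBDPLFunctionInt p ι 𝔭 κ γ f ΩK Ωp Q)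
    (hQ' : R1.IsBDPLFunctionInt p ι 𝔭 κ γ f ΩK' Ωp' Q') :
    ∃ (x b : ℂ_[p]) (V V' : ℕ → ℂ_[p]), ‖x - 1‖ < (p : ℝ)⁻¹ ∧ x ≠ 1 ∧ b ≠ 0 ∧
      (∀ j, IntSeries.HasValueAt Q (x ^ j - 1) (V j)) ∧
      (∀ j, IntSeries.HasValueAt Q' (x ^ j - 1) (V' j)) ∧ ∀ j, 0 < j → V' j = b ^ j * V j := by
  have hp : p.Prime := Fact.out
  -- the interpolation character and its value at `γ`
  obtain ⟨φ₀, m, ψ, hm, hunr, hinf, hav, hfac, hx1, hne⟩ :=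
    exists_interpolationCharacter hp2 ι K κ hK hκ γ hγ
  set e := (FramedRep.unitsContinuousMulEquivOfUnique (Fin 1) (PadicAlgCl p) :
    (PadicAlgCl p)ˣ →ₜ* GL (Fin 1) (PadicAlgCl p)) with he
  set x₀ : ℂ_[p] := avatarValueAt (e.comp ψ) γ with hx₀
  have hunr' : ∀ v : HeightOneSpectrum (𝓞 K), ((p : ℕ) : 𝓞 K) ∉ v.asIdeal → φ₀.IsUnramifiedAt v :=
    fun v _ => hunr v
  -- `a` with `‖x₀^{p^a} − 1‖ < p⁻¹`
  have hpinv : 0 < (p : ℝ)⁻¹ := inv_pos.mpr (by exact_mod_cast hp.pos)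
  obtain ⟨a, ha⟩ : ∃ a : ℕ, ‖x₀ ^ p ^ a - 1‖ < (p : ℝ)⁻¹ := by
    have h := tendsto_pow_prime_pow_padicComplex (p := p) hx1
    have hev := h.eventually (Metric.ball_mem_nhds (1 : ℂ_[p]) hpinv)
    obtain ⟨a, ha⟩ := hev.exists
    exact ⟨a, by rwa [dist_eq_norm] at ha⟩
  set x : ℂ_[p] := x₀ ^ p ^ a with hxdef
  have hxne : x ≠ 1 := hne a
  have hxlt : ‖x - 1‖ < 1 := ha.trans (inv_lt_one_of_one_lt₀ (by exact_mod_cast hp.one_lt))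
  -- generic values of `Q`, `Q'` at the points `x^j − 1`
  have hpt : ∀ j : ℕ, ‖x ^ j - 1‖ < 1 := fun j => (R1.norm_pow_sub_one_le hxlt j).trans_lt hxlt
  choose V hV using fun j : ℕ => intSeries_exists_hasValueAt Q (hpt j)
  choose V' hV' using fun j : ℕ => intSeries_exists_hasValueAt Q' (hpt j)
  -- the period ratio
  set β : ℂ_[p] := ((ι.symm ((ΩK / ΩK') ^ 4) : PadicAlgCl p) : ℂ_[p]) * (Ωp' / Ωp) ^ 4 with hβ
  have hβ0 : β ≠ 0 := by
    refine mul_ne_zero ?_ (pow_ne_zero _ (div_ne_zero hΩp' hΩp))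
    rw [PadicComplex.coe_eq]
    exact (map_ne_zero_iff _ (algebraMap (PadicAlgCl p) ℂ_[p]).injective).mpr
      ((map_ne_zero_iff _ ι.symm.injective).mpr (pow_ne_zero _ (div_ne_zero hΩK hΩK')))
  set b : ℂ_[p] := β ^ (m * p ^ a) with hbdef
  have hb : b ≠ 0 := pow_ne_zero _ hβ0
  -- the relation `V' j = b^j V j` for `j ≥ 1`, through the characters `φ₀^{p^a j}`
  have hrel : ∀ j, 0 < j → V' j = b ^ j * V j := by
    intro j hj
    set n : ℕ := p ^ a * j with hn
    have hn0 : 0 < m * n := Nat.mul_pos hm (Nat.mul_pos (pow_pos hp.pos a) hj)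
    have hunrn : ∀ v : HeightOneSpectrum (𝓞 K), (φ₀ ^ n).IsUnramifiedAt v :=
      fun v => isUnramifiedAt_pow' (hunr v) n
    have hinfn : (φ₀ ^ n).HasInfinityType (fun _ ↦ ((m * n : ℕ) : ℤ)) (fun _ ↦ -((m * n : ℕ) : ℤ)) := by
      have h := HasInfinityType.pow_nat hinf n
      convert h using 2 <;> push_cast <;> ring
    have havn : IsPAdicAvatarOf ι (φ₀ ^ n) (e.comp (ψ ^ n)) := isPAdicAvatarOf_pow ι hav hunr' n
    have hfacn : FactorsThroughZp κ (e.comp (ψ ^ n)) := factorsThroughZp_unitsChar_pow κ hfac n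
    have hvaln : avatarValueAt (e.comp (ψ ^ n)) γ = x ^ j := by
      rw [avatarValueAt_unitsChar_pow, ← hx₀, hxdef, ← pow_mul, hn]
    -- the values of the two frames at `x^j − 1`
    have h1 := hQ (φ₀ ^ n) (m * n) hn0 hunrn hinfn (e.comp (ψ ^ n)) havn hfacn
    have h2 := intSeries_hasValueAt_frame_rescale hΩK hΩK' hΩp hQ' hn0 hunrn hinfn havn hfacn
    rw [hvaln] at h1 h2
    have e1 : V j = _ := (hV j).unique h1
    have e2 : V' j = _ := (hV' j).unique h2
    rw [e2, e1, hbdef, ← hβ, ← pow_mul, show m * p ^ a * j = m * n by rw [hn]; ring]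
    ring
  exact ⟨x, b, V, V', ha, hxne, hb, hV, hV', hrel⟩

/-- **Two ♭-frames differ by a unit of `Λ = ℤ_p⟦T⟧`** (sharpening of
`R1.exists_unit_mul_eq_of_isBDPLFunctionInt`): `Q' = (map U)·Q` with `U ∈ Λˣ`.
[cite: Castella2018, Thm. 3.1 (arXiv:1704.06608 p. 9)] [cite: Washington1997, §7.1] -/
theorem R1.exists_iwasawaUnit_mul_eq_of_isBDPLFunctionInt (hp2 : p ≠ 2) (hK : IsImaginaryQuadratic K)
    (hκ : κ.IsAnticyclotomic) (hγ : κ.IsTopGenerator γ) (hΩK : ΩK ≠ 0) (hΩK' : ΩK' ≠ 0)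
    (hΩp : Ωp ≠ 0) (hΩp' : Ωp' ≠ 0) (hQ : R1.IsBDPLFunctionInt p ι 𝔭 κ γ f ΩK Ωp Q)
    (hQ' : R1.IsBDPLFunctionInt p ι 𝔭 κ γ f ΩK' Ωp' Q') :
    ∃ U : IwasawaAlgebra p, IsUnit U ∧ Q' = PowerSeries.map (R1.toCpInt p) U * Q := by
  obtain ⟨x, b, V, V', hx, hx1, hb, hV, hV', hrel⟩ :=
    R1.exists_frameValues_of_isBDPLFunctionInt hp2 hK hκ hγ hΩK hΩK' hΩp hΩp' hQ hQ'
  exact R1.exists_iwasawaUnit_mul_eq_of_values hx hx1 hb hV hV' hrel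

/-! ### §3 The `R₀`-frame twin (x11b3's currency `IsBDPLFunction`, `L ∈ R₀⟦T⟧`) -/

/-- `R₀ → 𝓞_{ℂ_p}` is injective (it is an inclusion of subrings of `ℂ_p`). [folklore] -/
theorem R1.unrToCpInt_injective : Function.Injective (R1.unrToCpInt p) := by
  intro a b h
  have h' := congrArg (fun z : 𝓞_ℂ_[p] ↦ (z : ℂ_[p])) h
  simp only [R1.coe_unrToCpInt] at h'
  exact Subtype.ext h'

/-- `R₀⟦T⟧ → 𝓞_{ℂ_p}⟦T⟧` (coefficientwise inclusion) is injective. [folklore] -/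
theorem R1.map_unrToCpInt_injective :
    Function.Injective (PowerSeries.map (R1.unrToCpInt p) : UnrSeries p → PowerSeries 𝓞_ℂ_[p]) :=
  PowerSeries.map_injective _ R1.unrToCpInt_injective

variable {L L' : UnrSeries p}

/-- **Two `R₀`-frames differ by a unit of `Λ = ℤ_p⟦T⟧`.** At an odd prime `p`, over an imaginary
quadratic `K`, for an anticyclotomic `κ` with topological generator `γ`: if `L, L' ∈ R₀⟦T⟧` satisfy
Castella's interpolation property `IsBDPLFunction ι 𝔭 κ γ f Ω_K Ω_p L`, `IsBDPLFunction ι 𝔭 κ γ f Ω_K' Ω_p' L'`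
with all four periods non-zero, then `L' = (map U)·L` for a unit `U` of `Λ` (read both in `𝓞_{ℂ_p}⟦T⟧`
by `R1.isBDPLFunctionInt_map`, apply §2, and pull back along the injective `R₀⟦T⟧ → 𝓞_{ℂ_p}⟦T⟧`,
`R1.map_unrToCpInt_map_toUnr`). [cite: Castella2018, Thm. 3.1 (arXiv:1704.06608 p. 9)]
[cite: CastellaHsieh2018, §3.3, Def. 3.5 and Prop. 3.6] -/
theorem R1.exists_iwasawaUnit_mul_eq_of_isBDPLFunction (hp2 : p ≠ 2) (hK : IsImaginaryQuadratic K)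
    (hκ : κ.IsAnticyclotomic) (hγ : κ.IsTopGenerator γ) (hΩK : ΩK ≠ 0) (hΩK' : ΩK' ≠ 0)
    (hΩp : Ωp ≠ 0) (hΩp' : Ωp' ≠ 0) (hL : IsBDPLFunction ι 𝔭 κ γ f ΩK Ωp L)
    (hL' : IsBDPLFunction ι 𝔭 κ γ f ΩK' Ωp' L') :
    ∃ U : IwasawaAlgebra p, IsUnit U ∧ L' = PowerSeries.map (toUnr p) U * L := by
  obtain ⟨U, hU, h⟩ := R1.exists_iwasawaUnit_mul_eq_of_isBDPLFunctionInt hp2 hK hκ hγ hΩK hΩK' hΩp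
    hΩp' (R1.isBDPLFunctionInt_map hL) (R1.isBDPLFunctionInt_map hL')
  refine ⟨U, hU, R1.map_unrToCpInt_injective ?_⟩
  rw [map_mul, R1.map_unrToCpInt_map_toUnr, ← h]

/-- **Two `R₀`-frames generate the same ideal of `R₀⟦T⟧`**: `Ideal.span {L'} = Ideal.span {L}`. Hence
every `R₀⟦T⟧`-ideal statement about `(L)` — e.g. an inclusion `Ch·R₀⟦T⟧ ⊆ (L)` or an equality
`Ch·R₀⟦T⟧ = (L)` — holds for one frame iff for any other (odd `p`, `K` imaginary quadratic, `κ`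
anticyclotomic, non-zero periods). [cite: Castella2018, Thm. 3.1 (arXiv:1704.06608 p. 9)] -/
theorem R1.span_singleton_eq_of_isBDPLFunction (hp2 : p ≠ 2) (hK : IsImaginaryQuadratic K)
    (hκ : κ.IsAnticyclotomic) (hγ : κ.IsTopGenerator γ) (hΩK : ΩK ≠ 0) (hΩK' : ΩK' ≠ 0)
    (hΩp : Ωp ≠ 0) (hΩp' : Ωp' ≠ 0) (hL : IsBDPLFunction ι 𝔭 κ γ f ΩK Ωp L)
    (hL' : IsBDPLFunction ι 𝔭 κ γ f ΩK' Ωp' L') :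
    Ideal.span ({L'} : Set (UnrSeries p)) = Ideal.span {L} := by
  obtain ⟨U, hU, h⟩ :=
    R1.exists_iwasawaUnit_mul_eq_of_isBDPLFunction hp2 hK hκ hγ hΩK hΩK' hΩp hΩp' hL hL'
  rw [h]
  exact Ideal.span_singleton_mul_left_unit (hU.map _) L

/-- **Ideal inclusions into `(L)` do not see the frame**: for any ideal `I ≤ R₀⟦T⟧`,
`I ≤ (L) ↔ I ≤ (L')` (the shape of the divisibility `Ch_Λ(X_ac)·R₀⟦T⟧ ⊆ (L)` in x11b3's ∀-over-`L`
half `Three.IMCDivAt₃` and of route R1's gen-20 `R₀`-shapes — the §1 (1.b) divisibility, from [Wan2020] Thm. 1.1 /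
[FW21, Thm. 4.41]). [cite: Castella2018, §1 (1.b) (arXiv:1704.06608 p. 3) and Thm. 4.4 (p. 11); proof of Thm. 4.2, display (wan-thm) (p. 10) (shape)]
[cite: Castella2018Erratum, Thm. 1.1 (p. 1)] -/
theorem R1.le_span_singleton_iff_of_isBDPLFunction (hp2 : p ≠ 2) (hK : IsImaginaryQuadratic K)
    (hκ : κ.IsAnticyclotomic) (hγ : κ.IsTopGenerator γ) (hΩK : ΩK ≠ 0) (hΩK' : ΩK' ≠ 0)
    (hΩp : Ωp ≠ 0) (hΩp' : Ωp' ≠ 0) (hL : IsBDPLFunction ι 𝔭 κ γ f ΩK Ωp L)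
    (hL' : IsBDPLFunction ι 𝔭 κ γ f ΩK' Ωp' L') (I : Ideal (UnrSeries p)) :
    I ≤ Ideal.span {L} ↔ I ≤ Ideal.span {L'} := by
  rw [R1.span_singleton_eq_of_isBDPLFunction hp2 hK hκ hγ hΩK hΩK' hΩp hΩp' hL hL']

/-! ### §4 Route R1's H3 predicates do not see the frame (pointwise, both currencies) -/

variable {W : WeierstrassCurve ℚ}

/-- **H3 in `R₀`-currency is frame-independent**: for two `R₀`-frames of the same `(ι, 𝔭, κ, γ, f)`
(odd `p`, `K` imaginary quadratic, `κ` anticyclotomic, non-zero periods), route R1's main-conjecture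
predicate `R1.IMCEqOnTreeAt W p κ 𝔭 γ L` (`Ch_Λ(X_ac^∅)·R₀⟦T⟧ = (L)`, erratum Thm. 1.1 SHAPE) holds at `L`
iff at `L'`. [cite: Castella2018Erratum, Thm. 1.1 (p. 1)] [cite: Castella2018, Thm. 3.1 (arXiv:1704.06608 p. 9)] -/
theorem R1.imcEqOnTreeAt_iff_of_isBDPLFunction (hp2 : p ≠ 2) (hK : IsImaginaryQuadratic K)
    (hκ : κ.IsAnticyclotomic) [hγ : Fact (κ.IsTopGenerator γ)] (hΩK : ΩK ≠ 0) (hΩK' : ΩK' ≠ 0)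
    (hΩp : Ωp ≠ 0) (hΩp' : Ωp' ≠ 0) (hL : IsBDPLFunction ι 𝔭 κ γ f ΩK Ωp L)
    (hL' : IsBDPLFunction ι 𝔭 κ γ f ΩK' Ωp' L') :
    R1.IMCEqOnTreeAt W p κ 𝔭 γ L ↔ R1.IMCEqOnTreeAt W p κ 𝔭 γ L' := by
  unfold R1.IMCEqOnTreeAt
  rw [R1.span_singleton_eq_of_isBDPLFunction hp2 hK hκ hγ.out hΩK hΩK' hΩp hΩp' hL hL']

/-- **∀-frame ⟸ ∃-frame for H3 in `R₀`-currency** (the two typings of the main-conjecture half agree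
given one frame): if SOME `R₀`-frame `(Ω_K ≠ 0, Ω_p ≠ 0, L)` of `(ι, 𝔭, κ, γ, f)` satisfies
`R1.IMCEqOnTreeAt W p κ 𝔭 γ L`, then EVERY `R₀`-frame with non-zero periods does (odd `p`, `K` imaginary
quadratic, `κ` anticyclotomic). The inner `∀ (Ω_K Ω_p L), IsBDPLFunction … L → …` of route R1's gen-21
shape `R1.IMCEqOnTree` and of x11b3's `Three.IMCDivAt₃` is of this kind.
[cite: Castella2018Erratum, Thm. 1.1 (p. 1)] [cite: Castella2018, Thm. 3.1 (arXiv:1704.06608 p. 9)] -/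
theorem R1.imcEqOnTreeAt_forall_of_exists (hp2 : p ≠ 2) (hK : IsImaginaryQuadratic K)
    (hκ : κ.IsAnticyclotomic) [Fact (κ.IsTopGenerator γ)]
    (h : ∃ (ΩK : ℂ) (Ωp : ℂ_[p]) (L : UnrSeries p), ΩK ≠ 0 ∧ Ωp ≠ 0 ∧
      IsBDPLFunction ι 𝔭 κ γ f ΩK Ωp L ∧ R1.IMCEqOnTreeAt W p κ 𝔭 γ L)
    {ΩK' : ℂ} {Ωp' : ℂ_[p]} {L' : UnrSeries p} (hΩK' : ΩK' ≠ 0) (hΩp' : Ωp' ≠ 0)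
    (hL' : IsBDPLFunction ι 𝔭 κ γ f ΩK' Ωp' L') : R1.IMCEqOnTreeAt W p κ 𝔭 γ L' := by
  obtain ⟨ΩK, Ωp, L, hΩK, hΩp, hL, h3⟩ := h
  exact (R1.imcEqOnTreeAt_iff_of_isBDPLFunction hp2 hK hκ hΩK hΩK' hΩp hΩp' hL hL').mp h3

/-- **∀-frame ⟸ ∃-frame for H3♭ over the wide receptacle**: if SOME ♭-frame `(Ω_K ≠ 0, Ω_p ≠ 0, Q)` of
`(ι, 𝔭, κ, γ, f)` satisfies `R1.IMCEqIntAt W p κ 𝔭 γ Q`, then EVERY ♭-frame with non-zero periods does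
(odd `p`, `K` imaginary quadratic, `κ` anticyclotomic; from `R1.imcEqIntAt_iff_of_isBDPLFunctionInt`).
[cite: Castella2018Erratum, Thm. 1.1 (p. 1)] [cite: Castella2018, Thm. 3.1 (arXiv:1704.06608 p. 9)] -/
theorem R1.imcEqIntAt_forall_of_exists (hp2 : p ≠ 2) (hK : IsImaginaryQuadratic K)
    (hκ : κ.IsAnticyclotomic) [Fact (κ.IsTopGenerator γ)]
    (h : ∃ (ΩK : ℂ) (Ωp : ℂ_[p]) (Q : PowerSeries 𝓞_ℂ_[p]), ΩK ≠ 0 ∧ Ωp ≠ 0 ∧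
      R1.IsBDPLFunctionInt p ι 𝔭 κ γ f ΩK Ωp Q ∧ R1.IMCEqIntAt W p κ 𝔭 γ Q)
    {ΩK' : ℂ} {Ωp' : ℂ_[p]} {Q' : PowerSeries 𝓞_ℂ_[p]} (hΩK' : ΩK' ≠ 0) (hΩp' : Ωp' ≠ 0)
    (hQ' : R1.IsBDPLFunctionInt p ι 𝔭 κ γ f ΩK' Ωp' Q') : R1.IMCEqIntAt W p κ 𝔭 γ Q' := by
  obtain ⟨ΩK, Ωp, Q, hΩK, hΩp, hQ, h3⟩ := h
  exact (R1.imcEqIntAt_iff_of_isBDPLFunctionInt hp2 hK hκ hΩK hΩK' hΩp hΩp' hQ hQ').mp h3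

end Frames

end Summit.BirchSwinnertonDyer.Rank1Residual.X11b

end
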